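import Mathlib.RingTheory.Ideal.Operations
import Mathlib.Data.Real.Basic
import HarnessLib

/-!
# Kawanoue 2007, Part I, §2.1.1 / Lemma 2.2.1.1: idealistic filtrations over a ring, generation, saturation operator

H. Kawanoue, *Toward resolution of singularities over a field of positive characteristic. Part I.
Foundation; the language of the idealistic filtration*, Publ. RIMS **43** (2007) 819–909
(= arXiv:math/0607009) [Kawanoue2007] — the «Idealistic Filtration Program» (IFP). This file types
Definition 2.1.1.1 (1)–(4), Remark 2.1.1.2 (1) and Lemma 2.2.1.1 (1)(2)(3) of Chapter 2 as REAL Lean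
definitions with their elementary API proved; NO named facts are introduced. Locators are the printed
item numbers (identical in the journal and arXiv versions); the pages were re-read on the held arXiv
text (`lit read paper:arxiv-math-0607009`, chunks p0050–p0055) before typing. Campaign `res-hironaka`
(D-0089), ladder rung LIT-6 (Kawanoue / IFP as a comparison programme); first consumer = the rescue
catalogue's definition row RR-133. The saturations (𝔇, ℜ, IC, 𝔅: Def. 2.1.2.1–2.1.5.1) are the sibling
file `IdealisticFiltrationSaturation.lean`.

## What is typed, and how (faithfulness notes)

* **Standing setting (§2.1).** «Let `R` be the coordinate ring of an affine open subset of a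
  nonsingular variety `W` over `k`, or its localization, or its completion». The definitions make sense
  for any commutative ring `R` and are typed in that generality; nothing here uses regularity.
* **Def. 2.1.1.1 (1)(2).** An idealistic filtration is «a subset `𝕀 ⊂ R × ℝ`» with (o) `𝕀_0 = R`,
  (i) every slice `𝕀_a = {f ; (f, a) ∈ 𝕀}` an ideal, (ii) `𝕀_a 𝕀_b ⊂ 𝕀_{a+b}`, (iii) `𝕀_b ⊃ 𝕀_a` for
  `b ≤ a`. We bundle it as the level function `level : ℝ → Ideal R` with exactly these axioms
  (`IdealisticFiltration`; (i) is the type); the printed subset is `carrier 𝕀 = {(f, a) ; f ∈ 𝕀_a}`,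
  the printed slice is `sliceAt`, and `IsIdealisticFiltrationSet` (the definition verbatim on subsets)
  with `ofSet` / `carrier_ofSet` / `ofSet_carrier` / `isIdealisticFiltrationSet_carrier` record that the
  two descriptions are the same thing. Remark 2.1.1.2 (1) (the pair conditions) = `mem_level_zero`,
  `zero_mem_level`, `add_mem`, `mul_mem_left`, `mul_mem`, `mem_of_le` (+ `pow_mem`).
* **Def. 2.1.1.1 (3), Lemma 2.2.1.1 (1)(2).** `inter S` = the intersection of a family (levelwise `⨅`;
  for the EMPTY family it is `R × ℝ`, the top filtration the printed proof uses to make its families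
  non-empty); `generate T = G(T)`, «the minimal idealistic filtration containing `T`», is the
  intersection of all filtrations containing `T` exactly as in the printed proof of Lemma 2.2.1.1 (2);
  `subset_carrier_generate` / `generate_incl` are its two defining properties; `IsGeneratedBy`.
  Inclusion `𝕀 ⊂ 𝕁` is the plain predicate `Incl` (no order instance is declared).
* **Def. 2.1.1.1 (4).** `IsRFG` («of r.f.g. type»: generated by a finite `T ⊂ R × ℚ`).
* **Lemma 2.2.1.1 (3), uniformly.** `satBy C 𝕀` = the intersection of all `C`-filtrations containing
  `𝕀` — «the minimal `C` idealistic filtration containing `𝕀`» as soon as `C` is stable under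
  intersections (`incl_satBy`, `satBy_incl`, `satBy_prop`, `satBy_eq_self`, `satBy_mono`); the sibling
  file instantiates `C` = 𝔇-saturated, ℜ-saturated, integrally closed, 𝔅-saturated.

Deliberately NOT here: Def. 2.1.1.1 (5)(6) (`μ_P`, `Supp`), the explicit generators of Lemma 2.2.1.2,
§2.3–2.4 (r.f.g. stability, localization, completion), Chapter 3 (leading algebra / leading generator
system). Nothing of Hironaka's 2017 manuscript is referred to or asserted.

## References

* H. Kawanoue, Publ. RIMS 43 (2007) 819–909 = arXiv:math/0607009: Def. 2.1.1.1, Rem. 2.1.1.2,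
  Lemma 2.2.1.1. [Kawanoue2007]
-/

namespace Literature.AlgebraicGeometry.Kawanoue2007

/-! ## Def. 2.1.1.1: idealistic filtrations -/

/-- **Idealistic filtration** over a commutative ring `R` [Kawanoue 2007, Def. 2.1.1.1 (2)]: «a subset
`𝕀 ⊂ R × ℝ`» such that «(o) `𝕀_0 = R`, (i) `𝕀_a` is an ideal of `R` for any `a ∈ ℝ` (`𝕀_a` is called the
ideal of `𝕀` at level `a`), (ii) `𝕀_a 𝕀_b ⊂ 𝕀_{a+b}` for any `a, b ∈ ℝ`, (iii) `𝕀_b ⊃ 𝕀_a` if `b ≤ a`»,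
bundled as its level function `a ↦ 𝕀_a` (condition (i) is the type `Ideal R`); the printed subset of
`R × ℝ` is `IdealisticFiltration.carrier`. [cite: Kawanoue2007, Def. 2.1.1.1 (2)] -/
structure IdealisticFiltration (R : Type*) [CommRing R] where
  /-- `𝕀_a`, «the ideal of `𝕀` at level `a`» (condition (i)). -/
  level : ℝ → Ideal R
  /-- (o) `𝕀_0 = R`. -/
  level_zero : level 0 = ⊤
  /-- (ii) `𝕀_a 𝕀_b ⊂ 𝕀_{a+b}`. -/
  mul_le : ∀ a b : ℝ, level a * level b ≤ level (a + b)
  /-- (iii) `𝕀_b ⊃ 𝕀_a` if `b ≤ a`. -/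
  antitone : Antitone level

/-- `T_a = {f ∈ R ; (f, a) ∈ T}`, the slice of a subset `T ⊂ R × ℝ` at level `a`.
[cite: Kawanoue2007, Def. 2.1.1.1 (1)] -/
def sliceAt {R : Type*} (T : Set (R × ℝ)) (a : ℝ) : Set R := {f | (f, a) ∈ T}

/-- `f ∈ T_a ↔ (f, a) ∈ T`. [cite: Kawanoue2007, Def. 2.1.1.1 (1)] -/
@[simp] theorem mem_sliceAt_iff {R : Type*} {T : Set (R × ℝ)} {a : ℝ} {f : R} :
    f ∈ sliceAt T a ↔ (f, a) ∈ T := Iff.rfl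

/-- **Def. 2.1.1.1 (2) verbatim, as a predicate on subsets `T ⊂ R × ℝ`**: (o) `T_0 = R`; (i) each `T_a`
is (the underlying set of) an ideal; (ii) `T_a T_b ⊂ T_{a+b}` (stated on products of elements, which
is the same as the product ideal given (i)); (iii) `T_a ⊂ T_b` for `b ≤ a`.
[cite: Kawanoue2007, Def. 2.1.1.1 (2)] -/
def IsIdealisticFiltrationSet {R : Type*} [CommRing R] (T : Set (R × ℝ)) : Prop :=
  sliceAt T 0 = Set.univ ∧
  (∀ a : ℝ, ∃ I : Ideal R, (I : Set R) = sliceAt T a) ∧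
  (∀ a b : ℝ, ∀ f ∈ sliceAt T a, ∀ g ∈ sliceAt T b, f * g ∈ sliceAt T (a + b)) ∧
  (∀ a b : ℝ, b ≤ a → sliceAt T a ⊆ sliceAt T b)

namespace IdealisticFiltration

variable {R : Type*} [CommRing R]

/-- Two idealistic filtrations with the same levels are equal (they are the same subset of `R × ℝ`).
[cite: Kawanoue2007, Def. 2.1.1.1 (1)(2)] -/
@[ext] theorem ext {𝕀 𝕁 : IdealisticFiltration R} (h : ∀ a, 𝕀.level a = 𝕁.level a) : 𝕀 = 𝕁 := by
  obtain ⟨l₁, _, _, _⟩ := 𝕀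
  obtain ⟨l₂, _, _, _⟩ := 𝕁
  have : l₁ = l₂ := funext h
  subst this
  rfl

/-- The printed subset `𝕀 ⊂ R × ℝ`: `(f, a) ∈ 𝕀 ↔ f ∈ 𝕀_a`. [cite: Kawanoue2007, Def. 2.1.1.1 (1)(2)] -/
def carrier (𝕀 : IdealisticFiltration R) : Set (R × ℝ) := {x | x.1 ∈ 𝕀.level x.2}

/-- `(f, a) ∈ 𝕀 ↔ f ∈ 𝕀_a`. [cite: Kawanoue2007, Def. 2.1.1.1 (1)(2)] -/
@[simp] theorem mem_carrier_iff (𝕀 : IdealisticFiltration R) (x : R × ℝ) :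
    x ∈ 𝕀.carrier ↔ x.1 ∈ 𝕀.level x.2 := Iff.rfl

/-- The slice of the carrier at level `a` is the ideal `𝕀_a`. [cite: Kawanoue2007, Def. 2.1.1.1 (1)(2)] -/
theorem sliceAt_carrier (𝕀 : IdealisticFiltration R) (a : ℝ) :
    sliceAt 𝕀.carrier a = (𝕀.level a : Set R) := rfl

/-! ### Remark 2.1.1.2 (1): the pair conditions -/

/-- For `a ≤ 0` the level is the whole ring ((o) with (iii)). [cite: Kawanoue2007, Def. 2.1.1.1 (2)] -/
theorem level_eq_top_of_nonpos (𝕀 : IdealisticFiltration R) {a : ℝ} (ha : a ≤ 0) : 𝕀.level a = ⊤ :=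
  eq_top_iff.mpr (𝕀.level_zero ▸ 𝕀.antitone ha)

/-- (o) `(f, 0) ∈ 𝕀` for all `f ∈ R`. [cite: Kawanoue2007, Rem. 2.1.1.2 (1) (o)] -/
theorem mem_level_zero (𝕀 : IdealisticFiltration R) (f : R) : f ∈ 𝕀.level 0 := by
  rw [𝕀.level_zero]; trivial

/-- `(f, a) ∈ 𝕀` for all `f` whenever `a ≤ 0`. [cite: Kawanoue2007, Rem. 2.1.1.2 (1) (o) with (iii)] -/
theorem mem_level_of_nonpos (𝕀 : IdealisticFiltration R) {a : ℝ} (ha : a ≤ 0) (f : R) :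
    f ∈ 𝕀.level a := by
  rw [𝕀.level_eq_top_of_nonpos ha]; trivial

/-- (o) `(0, a) ∈ 𝕀` for all `a ∈ ℝ`. [cite: Kawanoue2007, Rem. 2.1.1.2 (1) (o)] -/
theorem zero_mem_level (𝕀 : IdealisticFiltration R) (a : ℝ) : (0 : R) ∈ 𝕀.level a :=
  Submodule.zero_mem _

/-- (i) `(f, a), (g, a) ∈ 𝕀 ⇒ (f + g, a) ∈ 𝕀`. [cite: Kawanoue2007, Rem. 2.1.1.2 (1) (i)] -/
theorem add_mem (𝕀 : IdealisticFiltration R) {a : ℝ} {f g : R} (hf : f ∈ 𝕀.level a)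
    (hg : g ∈ 𝕀.level a) : f + g ∈ 𝕀.level a :=
  Submodule.add_mem _ hf hg

/-- (i) `r ∈ R, (f, a) ∈ 𝕀 ⇒ (r f, a) ∈ 𝕀`. [cite: Kawanoue2007, Rem. 2.1.1.2 (1) (i)] -/
theorem mul_mem_left (𝕀 : IdealisticFiltration R) {a : ℝ} (r : R) {f : R} (hf : f ∈ 𝕀.level a) :
    r * f ∈ 𝕀.level a :=
  Ideal.mul_mem_left _ r hf

/-- (ii) `(f, a), (h, b) ∈ 𝕀 ⇒ (f h, a + b) ∈ 𝕀`. [cite: Kawanoue2007, Rem. 2.1.1.2 (1) (ii)] -/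
theorem mul_mem (𝕀 : IdealisticFiltration R) {a b : ℝ} {f h : R} (hf : f ∈ 𝕀.level a)
    (hh : h ∈ 𝕀.level b) : f * h ∈ 𝕀.level (a + b) :=
  𝕀.mul_le a b (Ideal.mul_mem_mul hf hh)

/-- (iii) `(f, a) ∈ 𝕀, b ≤ a ⇒ (f, b) ∈ 𝕀`. [cite: Kawanoue2007, Rem. 2.1.1.2 (1) (iii)] -/
theorem mem_of_le (𝕀 : IdealisticFiltration R) {a b : ℝ} (hba : b ≤ a) {f : R} (hf : f ∈ 𝕀.level a) :
    f ∈ 𝕀.level b :=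
  𝕀.antitone hba hf

/-- `(f, a) ∈ 𝕀 ⇒ (f^n, n a) ∈ 𝕀` (iterate (ii); `n = 0` is (o)). [cite: Kawanoue2007, Rem. 2.1.1.2 (1) (o)(ii)] -/
theorem pow_mem (𝕀 : IdealisticFiltration R) {a : ℝ} {f : R} (hf : f ∈ 𝕀.level a) :
    ∀ n : ℕ, f ^ n ∈ 𝕀.level (n * a)
  | 0 => by simpa using 𝕀.mem_level_zero 1
  | n + 1 => by
    have h := 𝕀.mul_mem (𝕀.pow_mem hf n) hf
    have e : ((n : ℝ) * a + a) = ((n + 1 : ℕ) : ℝ) * a := by push_cast; ring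
    rw [pow_succ, ← e]; exact h

/-! ### The subset description and the bundled description agree -/

/-- The carrier of an idealistic filtration satisfies Def. 2.1.1.1 (2) as printed.
[cite: Kawanoue2007, Def. 2.1.1.1 (2)] -/
theorem isIdealisticFiltrationSet_carrier (𝕀 : IdealisticFiltration R) :
    IsIdealisticFiltrationSet 𝕀.carrier := by
  refine ⟨?_, fun a => ⟨𝕀.level a, rfl⟩, fun a b f hf g hg => 𝕀.mul_mem hf hg,
    fun a b hba f hf => 𝕀.mem_of_le hba hf⟩
  ext f
  simpa using 𝕀.mem_level_zero f

/-- **From the printed subset to the bundled filtration**: a subset `T ⊂ R × ℝ` satisfying Def. 2.1.1.1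
(2) IS an idealistic filtration with levels `T_a`. [cite: Kawanoue2007, Def. 2.1.1.1 (2)] -/
def ofSet (T : Set (R × ℝ)) (hT : IsIdealisticFiltrationSet T) : IdealisticFiltration R where
  level a :=
    { carrier := sliceAt T a
      add_mem' := fun {f g} hf hg => by
        obtain ⟨I, hI⟩ := hT.2.1 a
        rw [← hI] at hf hg ⊢
        exact I.add_mem hf hg
      zero_mem' := by
        obtain ⟨I, hI⟩ := hT.2.1 a
        rw [← hI]; exact I.zero_mem
      smul_mem' := fun r {f} hf => by
        obtain ⟨I, hI⟩ := hT.2.1 a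
        rw [← hI] at hf ⊢
        exact I.smul_mem r hf }
  level_zero := by
    ext f
    change f ∈ sliceAt T 0 ↔ f ∈ (⊤ : Ideal R)
    rw [hT.1]; simp
  mul_le a b := Ideal.mul_le.mpr fun f hf g hg => hT.2.2.1 a b f hf g hg
  antitone a b hba := fun f hf => hT.2.2.2 b a hba hf

/-- The levels of `ofSet T` are the slices `T_a`. [cite: Kawanoue2007, Def. 2.1.1.1 (1)(2)] -/
@[simp] theorem mem_level_ofSet_iff {T : Set (R × ℝ)} (hT : IsIdealisticFiltrationSet T) {a : ℝ}
    {f : R} : f ∈ (ofSet T hT).level a ↔ (f, a) ∈ T := Iff.rfl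

/-- `ofSet` recovers the printed subset: `carrier (ofSet T) = T`. [cite: Kawanoue2007, Def. 2.1.1.1 (2)] -/
theorem carrier_ofSet {T : Set (R × ℝ)} (hT : IsIdealisticFiltrationSet T) : (ofSet T hT).carrier = T := by
  ext ⟨f, a⟩; rfl

/-- … and `ofSet (carrier 𝕀) = 𝕀`. [cite: Kawanoue2007, Def. 2.1.1.1 (2)] -/
theorem ofSet_carrier (𝕀 : IdealisticFiltration R) :
    ofSet 𝕀.carrier 𝕀.isIdealisticFiltrationSet_carrier = 𝕀 := by
  ext a f; rfl

/-! ### Inclusion, intersections, generation (Def. 2.1.1.1 (3)(4), Lemma 2.2.1.1 (1)(2)) -/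

/-- `𝕀 ⊂ 𝕁` (inclusion of idealistic filtrations as subsets of `R × ℝ`, i.e. `𝕀_a ⊂ 𝕁_a` for every
`a`); a plain predicate, no order instance. [cite: Kawanoue2007, Def. 2.1.1.1 (3)] -/
def Incl (𝕀 𝕁 : IdealisticFiltration R) : Prop := ∀ a : ℝ, 𝕀.level a ≤ 𝕁.level a

/-- `𝕀 ⊂ 𝕁` iff `carrier 𝕀 ⊆ carrier 𝕁`. [cite: Kawanoue2007, Def. 2.1.1.1 (3)] -/
theorem incl_iff_carrier_subset {𝕀 𝕁 : IdealisticFiltration R} : Incl 𝕀 𝕁 ↔ 𝕀.carrier ⊆ 𝕁.carrier :=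
  ⟨fun h x hx => h x.2 hx, fun h a f hf => by
    have := h (show (f, a) ∈ 𝕀.carrier from hf); exact this⟩

/-- `Incl` is reflexive (set inclusion in `R × ℝ`). [cite: Kawanoue2007, Def. 2.1.1.1 (2)(3)] -/
theorem Incl.rfl {𝕀 : IdealisticFiltration R} : Incl 𝕀 𝕀 := fun _ => le_rfl

/-- `Incl` is transitive (set inclusion in `R × ℝ`). [cite: Kawanoue2007, Def. 2.1.1.1 (2)(3)] -/
theorem Incl.trans {𝕀 𝕁 𝕂 : IdealisticFiltration R} (h₁ : Incl 𝕀 𝕁) (h₂ : Incl 𝕁 𝕂) : Incl 𝕀 𝕂 :=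
  fun a => (h₁ a).trans (h₂ a)

/-- `Incl` is antisymmetric (set inclusion in `R × ℝ`). [cite: Kawanoue2007, Def. 2.1.1.1 (2)(3)] -/
theorem Incl.antisymm {𝕀 𝕁 : IdealisticFiltration R} (h₁ : Incl 𝕀 𝕁) (h₂ : Incl 𝕁 𝕀) : 𝕀 = 𝕁 :=
  ext fun a => le_antisymm (h₁ a) (h₂ a)

/-- **The intersection `⋂_λ 𝕀_λ` of a family of idealistic filtrations** (levelwise), an idealistic
filtration; for the empty family this is `R × ℝ` (all levels `= R`).
[cite: Kawanoue2007, Lemma 2.2.1.1 (1)] -/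
def inter (S : Set (IdealisticFiltration R)) : IdealisticFiltration R where
  level a := ⨅ 𝕀 ∈ S, 𝕀.level a
  level_zero := eq_top_iff.mpr (le_iInf₂ fun 𝕀 _ => by rw [𝕀.level_zero])
  mul_le a b := by
    refine Ideal.mul_le.mpr fun f hf g hg => ?_
    simp only [Submodule.mem_iInf] at hf hg ⊢
    exact fun 𝕀 h𝕀 => 𝕀.mul_mem (hf 𝕀 h𝕀) (hg 𝕀 h𝕀)
  antitone a b hab := iInf₂_mono fun 𝕀 _ => 𝕀.antitone hab

/-- Membership in a level of the intersection. [cite: Kawanoue2007, Lemma 2.2.1.1 (1)] -/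
@[simp] theorem mem_level_inter_iff {S : Set (IdealisticFiltration R)} {a : ℝ} {f : R} :
    f ∈ (inter S).level a ↔ ∀ 𝕀 ∈ S, f ∈ 𝕀.level a := by
  simp [inter, Submodule.mem_iInf]

/-- The carrier of the intersection is the intersection of the carriers. [cite: Kawanoue2007, Lemma 2.2.1.1 (1)] -/
theorem carrier_inter (S : Set (IdealisticFiltration R)) : (inter S).carrier = ⋂ 𝕀 ∈ S, 𝕀.carrier := by
  ext ⟨f, a⟩; simp

/-- `⋂ S ⊂ 𝕀` for `𝕀 ∈ S`. [cite: Kawanoue2007, Lemma 2.2.1.1 (1)] -/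
theorem inter_incl {S : Set (IdealisticFiltration R)} {𝕀 : IdealisticFiltration R} (h : 𝕀 ∈ S) :
    Incl (inter S) 𝕀 := fun _ _ hf => mem_level_inter_iff.mp hf 𝕀 h

/-- `𝕁 ⊂ ⋂ S` when `𝕁 ⊂ 𝕀` for every `𝕀 ∈ S`. [cite: Kawanoue2007, Lemma 2.2.1.1 (1)] -/
theorem incl_inter {S : Set (IdealisticFiltration R)} {𝕁 : IdealisticFiltration R}
    (h : ∀ 𝕀 ∈ S, Incl 𝕁 𝕀) : Incl 𝕁 (inter S) :=
  fun a _ hf => mem_level_inter_iff.mpr fun 𝕀 h𝕀 => h 𝕀 h𝕀 a hf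

/-- **`G(T)`, the idealistic filtration generated by `T ⊂ R × ℝ`**: «the minimal idealistic filtration
containing `T`», constructed as in the printed proof of Lemma 2.2.1.1 (2) as the intersection of all
idealistic filtrations containing `T`. [cite: Kawanoue2007, Def. 2.1.1.1 (3) and Lemma 2.2.1.1 (2)] -/
def generate (T : Set (R × ℝ)) : IdealisticFiltration R := inter {𝕀 | T ⊆ 𝕀.carrier}

/-- `T ⊂ G(T)`. [cite: Kawanoue2007, Def. 2.1.1.1 (3)] -/
theorem subset_carrier_generate (T : Set (R × ℝ)) : T ⊆ (generate T).carrier :=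
  fun _ h => mem_level_inter_iff.mpr fun _ h𝕀 => h𝕀 h

/-- Minimality: `G(T) ⊂ 𝕀` for every idealistic filtration `𝕀 ⊃ T`. [cite: Kawanoue2007, Def. 2.1.1.1 (3)] -/
theorem generate_incl {T : Set (R × ℝ)} {𝕀 : IdealisticFiltration R} (h : T ⊆ 𝕀.carrier) :
    Incl (generate T) 𝕀 :=
  inter_incl h

/-- `G` is monotone in `T`. [cite: Kawanoue2007, Def. 2.1.1.1 (3)] -/
theorem generate_mono {T T' : Set (R × ℝ)} (h : T ⊆ T') : Incl (generate T) (generate T') :=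
  generate_incl (h.trans (subset_carrier_generate T'))

/-- `G(carrier 𝕀) = 𝕀`. [cite: Kawanoue2007, Def. 2.1.1.1 (3)] -/
theorem generate_carrier (𝕀 : IdealisticFiltration R) : generate 𝕀.carrier = 𝕀 :=
  Incl.antisymm (generate_incl subset_rfl) (incl_iff_carrier_subset.mpr (subset_carrier_generate _))

/-- «If `𝕀 = G(T)`, we call `T` a set of generators for `𝕀`». [cite: Kawanoue2007, Def. 2.1.1.1 (3)] -/
def IsGeneratedBy (𝕀 : IdealisticFiltration R) (T : Set (R × ℝ)) : Prop := 𝕀 = generate T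

/-- **r.f.g. type** («rationally and finitely generated»): `𝕀 = G(T)` for a finite `T ⊂ R × ℚ ⊂ R × ℝ`.
[cite: Kawanoue2007, Def. 2.1.1.1 (4)] -/
def IsRFG (𝕀 : IdealisticFiltration R) : Prop :=
  ∃ T : Set (R × ℝ), T.Finite ∧ (∀ x ∈ T, ∃ q : ℚ, (q : ℝ) = x.2) ∧ 𝕀.IsGeneratedBy T

/-! ### The generic saturation operator (Lemma 2.2.1.1 (3)) -/

/-- `satBy C 𝕀`: the intersection of all idealistic filtrations `𝕁 ⊃ 𝕀` with property `C` — «the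
minimal `C` idealistic filtration containing `𝕀`» whenever `C` is stable under intersections
(printed proof of Lemma 2.2.1.1 (3); the family is never empty there since `R × ℝ` belongs to it, and
here `inter ∅ = R × ℝ` anyway). [cite: Kawanoue2007, Lemma 2.2.1.1 (3)] -/
def satBy (C : IdealisticFiltration R → Prop) (𝕀 : IdealisticFiltration R) : IdealisticFiltration R :=
  inter {𝕁 | Incl 𝕀 𝕁 ∧ C 𝕁}

/-- `𝕀 ⊂ satBy C 𝕀`. [cite: Kawanoue2007, Lemma 2.2.1.1 (3)] -/
theorem incl_satBy (C : IdealisticFiltration R → Prop) (𝕀 : IdealisticFiltration R) : Incl 𝕀 (satBy C 𝕀) :=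
  incl_inter fun _ h => h.1

/-- Minimality: `satBy C 𝕀 ⊂ 𝕁` for every `C`-filtration `𝕁 ⊃ 𝕀`. [cite: Kawanoue2007, Lemma 2.2.1.1 (3)] -/
theorem satBy_incl {C : IdealisticFiltration R → Prop} {𝕀 𝕁 : IdealisticFiltration R} (h𝕁 : Incl 𝕀 𝕁)
    (hC : C 𝕁) : Incl (satBy C 𝕀) 𝕁 :=
  inter_incl ⟨h𝕁, hC⟩

/-- If `C` is stable under intersections then `satBy C 𝕀` has property `C`.
[cite: Kawanoue2007, Lemma 2.2.1.1 (1)(3)] -/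
theorem satBy_prop {C : IdealisticFiltration R → Prop}
    (hC : ∀ S : Set (IdealisticFiltration R), (∀ 𝕁 ∈ S, C 𝕁) → C (inter S))
    (𝕀 : IdealisticFiltration R) : C (satBy C 𝕀) :=
  hC _ fun _ h => h.2

/-- A `C`-filtration is its own `C`-saturation. [cite: Kawanoue2007, Lemma 2.2.1.1 (3)] -/
theorem satBy_eq_self {C : IdealisticFiltration R → Prop} {𝕀 : IdealisticFiltration R} (h : C 𝕀) :
    satBy C 𝕀 = 𝕀 :=
  Incl.antisymm (satBy_incl Incl.rfl h) (incl_satBy C 𝕀)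

/-- `satBy C` is monotone. [cite: Kawanoue2007, Lemma 2.2.1.1 (3)] -/
theorem satBy_mono {C : IdealisticFiltration R → Prop}
    (hC : ∀ S : Set (IdealisticFiltration R), (∀ 𝕁 ∈ S, C 𝕁) → C (inter S))
    {𝕀 𝕁 : IdealisticFiltration R} (h : Incl 𝕀 𝕁) : Incl (satBy C 𝕀) (satBy C 𝕁) :=
  satBy_incl (h.trans (incl_satBy C 𝕁)) (satBy_prop hC 𝕁)

end IdealisticFiltration

end Literature.AlgebraicGeometry.Kawanoue2007
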